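import Literature.Computability.Cryptography.PeriodFindingInputBlock
import Literature.Computability.Cryptography.PeriodFindingFamily
import HarnessLib

/-!
# Period finding by eigenvalue estimation of shifts — the family reading the INPUT, and its law

Topic `Computability/Cryptography`; continues `PeriodFindingInputBlock.lean`. The quantum core of
`PeriodFindingFamily.lean` (Kitaev's Hadamard tests around the classical block, for every candidate
block length and trial, Aaronson–Chen 2017 App. 13) with the block replaced by the input-reading
block `blockCircI`: same specification `spec P n`, same layout, same control types, hence the same
read-out analysis downstream (`PeriodFindingAccuracy/Rule/Units`), but the per-unit answer tables now
depend on the input string: **`family_lawI`** — on input `x` of length `n`, relative to any oracle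
`A`, the structured control read-out follows `prob (unitLaw L (FuI A (bits x)))` (units independent,
each the mixture over characters of Kitaev tests). Theorem-and-definition file, no named facts.

* `familyI P`, `blockRI_iff_shift` (hypothesis `hR` of `sandwich_law_struct`), `family_lawI`,
  `family_law_strI` (the law on output strings, through `readOf`).

## References

* A. Yu. Kitaev, arXiv:quant-ph/9511026 (1995), §3 (Lemma 8, Lemma 10), §4 [Kitaev1995].
* S. Aaronson, L. Chen, CCC 2017 (arXiv:1612.05903), Lemma 7.5, App. 13 [AaronsonChen2017].
* S. Hallgren, J. ACM 54 (2007), Art. 4, §4 [Hallgren2007].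
-/

noncomputable section

namespace Literature.Computability.Cryptography

namespace PeriodFinding

open QuantumComplexity QuantumComplexity.RazTalMachine QuantumComplexity.RevSim QuantumComplexity.OSim
  Finset Function Matrix Kitaev1995 Complexity

variable (P : FParams) (n : ℕ)

/-- **The input-reading quantum core**: on inputs of length `n`, the sandwich circuit around the
input-reading block of `spec P n`. [cite: AaronsonChen2017, App. 13 (proof of Lemma 7.5)] [cite: Hallgren2007, §4] -/
def familyI : QCircuitFamily cliffordT where
  ancillas n := (k₁ (spec P n) + k₂ (spec P n)) + mW (spec P n)
  circ n := sandwich (blockCircI (spec P n) n) (famσ P n)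

/-- **Hypothesis `hR` of the read-out law** for the input-reading block: two control strings give the
same work-register content iff every unit's answer table (for the input bits) takes the same value at
the shifted offset `Z_u − A_u(y) (mod 2^{L_u})`. [cite: Kitaev1995, §3 Lemma 10] -/
theorem blockRI_iff_shift (A : Language Bool) (x : QReg n) (Z : QReg (k₂ (spec P n))) (yf yf' : QReg (k₁ (spec P n))) :
    blockRI (spec P n) n A x yf Z = blockRI (spec P n) n A x yf' Z ↔
      ∀ u, FuI (spec P n) A (List.ofFn x) u (shiftMod (Qof (spec P n).L u)
          ((((zvEquiv P n Z).1 u : Fin _) : ℕ) - (trialExp (un P n) (lev P n) u yf : ℤ))) =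
        FuI (spec P n) A (List.ofFn x) u (shiftMod (Qof (spec P n).L u)
          ((((zvEquiv P n Z).1 u : Fin _) : ℕ) - (trialExp (un P n) (lev P n) u yf' : ℤ))) := by
  have key : ∀ y : QReg (k₁ (spec P n)), ∀ u, shiftMod (Qof (spec P n).L u)
      ((((zvEquiv P n Z).1 u : Fin _) : ℕ) - (trialExp (un P n) (lev P n) u y : ℤ)) =
      xval (spec P n) (yOfFlat (spec P n) y) (zOfFlat (spec P n) Z) u := by
    intro y u
    apply Int.natCast_inj.1
    rw [shiftMod, Int.toNat_of_nonneg (Int.emod_nonneg _ (by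
        have := Qof_pos (spec P n).L u; exact_mod_cast this.ne')),
      xval_eq_emod, val_zvEquiv P n Z u y, trialExp_eq_sum]
    push_cast
    rfl
  simp_rw [key]
  exact blockRI_eq_iff A x yf yf' Z

/-- **The read-out law of the input-reading quantum core, relative to any oracle**: on an input `x`
of length `n`, the Born probability that the structured control read-out lies in `E` is
`prob (unitLaw L (FuI A (bits x))) E`. [cite: Kitaev1995, §3 (Lemma 8, Lemma 10) and §4; Shor1997, §5] -/
theorem family_lawI (A : Language Bool) (x : QReg n)
    (E : Finset (Fin (nU P n) → TIdx (Lv P n) (Bn P n) → Bool)) :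
    ∑ z ∈ univ.filter (fun z : QReg (NN (spec P n) n) =>
        structRead (eCtl P n) (fun j => z (yWire n (k₁ (spec P n)) (k₂ (spec P n)) (mW (spec P n)) j)) ∈ E),
        ‖((familyI P).circ n).runOn A (basisState (padInput x _)) z‖ ^ 2 =
      prob (X := fun _ : Fin (nU P n) => TIdx (Lv P n) (Bn P n) → Bool)
        (unitLaw (spec P n).L (FuI (spec P n) A (List.ofFn x))) E :=
  sandwich_law_struct (spec P n).L (FuI (spec P n) A (List.ofFn x)) (eCtl P n) (un := un P n) (lev := lev P n)
    (σ := famσ P n) (fun _ => rfl) (fun _ => rfl) (fun _ => rfl) (zvEquiv P n) A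
    (blockCircI (spec P n) n) x (blockRI (spec P n) n A x)
    (fun yf Z => blockCircI_mulVec_coinInput A x yf Z)
    (fun Z y y' => blockRI_iff_shift P n A x Z y y') E

/-- **The law on output strings**: the probability that the output string's structured read-out lies
in `E`. [cite: Kitaev1995, §3–§4] -/
theorem family_law_strI (A : Language Bool) (x : QReg n) (E : Finset (Readout P n))
    [DecidablePred (· ∈ {y : List Bool | readOf P n y ∈ E})] :
    ∑ z : QReg (NN (spec P n) n), (if List.ofFn z ∈ {y : List Bool | readOf P n y ∈ E} then
        ‖((familyI P).circ n).runOn A (basisState (padInput x _)) z‖ ^ 2 else 0) =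
      prob (X := fun _ : Fin (nU P n) => TIdx (Lv P n) (Bn P n) → Bool)
        (unitLaw (spec P n).L (FuI (spec P n) A (List.ofFn x))) E := by
  rw [← family_lawI P n A x E, sum_filter]
  refine sum_congr rfl fun z _ => ?_
  have hr : List.ofFn z ∈ {y : List Bool | readOf P n y ∈ E} ↔ structRead (eCtl P n)
      (fun j => z (yWire n (k₁ (spec P n)) (k₂ (spec P n)) (mW (spec P n)) j)) ∈ E := by
    rw [Set.mem_setOf_eq]
    unfold readOf
    rw [ctlOf_ofFn]
  by_cases h : structRead (eCtl P n) (fun j => z (yWire n (k₁ (spec P n)) (k₂ (spec P n)) (mW (spec P n)) j)) ∈ E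
  · rw [if_pos (hr.2 h), if_pos h]
  · rw [if_neg (fun h' => h (hr.1 h')), if_neg h]

end PeriodFinding

end Literature.Computability.Cryptography

end
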